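import Summits.Ventures.PercRepro.C026TwoHubFlip
import Summits.Ventures.PercRepro.C026TwoHubGoodCount

/-!
# THEOREM B: ROW C-041 `(G⅔)` holds on the two-hub class, hence THEOREM L2 there (p6, gen 22)

mine-3's THEOREM B (proofs/MINE3-G23-card.md; MINE3-GLUING.md §40 (j)): on every skeleton
`H = G.attachTwoHub a b h h'` — the terminals `a, b` adjacent, every other neighbour of a terminal
one of the two hubs `h, h'`, each adjacent to both terminals, `G` (the hub graph `G⁺`) arbitrary —
the average Good-degree of a `(D,A)` source is at least `2/3`:

  `2·n(D,A) ≤ 3·(#Good_a + #Good_b)`   (`twoHub_goodDegree`).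

The class contains every known equality case of `(G⅔)` (the hub, the double hub / 6-core, W9), so
the theorem is sharp.  PROOF (STEP 3 of the card, with the counts of C026TwoHubCount /
C026TwoHubGoodCount and the lemma of C026TwoHubFlip; notation `R = c ~_red h`, `B = c ~_blue h`,
`B'' = h ~_blue h'`, primes for `h'`, `R^{av}` = `c ~_red h` avoiding the blue cluster of `h'`):
`n(D,A) = N₁ + 2(P + Z) + 2(P' + Z') + 2U + 2V` and `#Good_a = #Good_b = N₁ + P + X + P' + X'`,
so `(G⅔)` is `(★) 2(Z + Z' + U + V) ≤ 2N₁ + P + P' + 3(X + X')`; with `a₀ = #{¬B, ¬B', R, R'}`,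
`b = #{¬B, ¬B', R, ¬R'}`, `b' = #{¬B, ¬B', R', ¬R}`, `z₁ = #{B, ¬B', ¬R, R'}`,
`z₁' = #{B', ¬B, ¬R', R}`, `W = #{(R ∨ R') ∧ (B ∨ B')}`: `Z = b' + z₁`, `Z' = b + z₁'`,
`U = a₀ + b + b'`, `V ≤ U`, `N₁ = U + W`, `z₁ + z₁' ≤ W`, `P ≥ a₀ + b`, `P' ≥ a₀ + b'`, and the
lemma `b ≤ X`, `b' ≤ X'` — then `(★)` is linear arithmetic.

COROLLARY (`pFun_threeCells_nonneg_twoHub`): THEOREM L2 — CONJECTURE (P) at every band state of the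
probe and the two live vertices — holds unconditionally on every two-hub skeleton, through the
bridge `pFun_threeCells_nonneg_of_goodDegree` of C026GoodDegreeBridge.
-/

namespace PercRepro

namespace MultiGraph

open Finset

variable {V E : Type*} {G : MultiGraph V E} {a b h h' c : V}

section Bookkeeping

variable [Fintype E] [DecidableEq E]

open Classical in
/-- `#{(R ∨ R') ∧ ¬B'} = #{¬B' ∧ R} + #{¬B' ∧ ¬R ∧ R'}`. -/
theorem card_PZ_split (c h h' : V) :
    (univ.filter fun O : Config E => (G.Conn O c h ∨ G.Conn O c h') ∧ ¬ G.Conn Oᶜ c h').card =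
      (univ.filter fun O : Config E => ¬ G.Conn Oᶜ c h' ∧ G.Conn O c h).card +
      (univ.filter fun O : Config E => ¬ G.Conn Oᶜ c h' ∧ ¬ G.Conn O c h ∧ G.Conn O c h').card := by
  rw [← Finset.card_union_of_disjoint]
  · congr 1
    ext O
    simp only [mem_filter, mem_union, mem_univ, true_and]
    tauto
  · rw [Finset.disjoint_left]
    intro O h1 h2
    simp only [mem_filter, mem_univ, true_and] at h1 h2
    exact h2.2.1 h1.2

open Classical in
/-- `#{¬B' ∧ ¬R ∧ R'} = #{(¬B ∧ ¬B') ∧ R' ∧ ¬R} + #{B ∧ ¬B' ∧ ¬R ∧ R'}`. -/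
theorem card_Z_split (c h h' : V) :
    (univ.filter fun O : Config E => ¬ G.Conn Oᶜ c h' ∧ ¬ G.Conn O c h ∧ G.Conn O c h').card =
      (univ.filter fun O : Config E =>
        (¬ G.Conn Oᶜ c h ∧ ¬ G.Conn Oᶜ c h') ∧ G.Conn O c h' ∧ ¬ G.Conn O c h).card +
      (univ.filter fun O : Config E =>
        G.Conn Oᶜ c h ∧ ¬ G.Conn Oᶜ c h' ∧ ¬ G.Conn O c h ∧ G.Conn O c h').card := by
  rw [← Finset.card_union_of_disjoint]
  · congr 1
    ext O
    simp only [mem_filter, mem_union, mem_univ, true_and]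
    tauto
  · rw [Finset.disjoint_left]
    intro O h1 h2
    simp only [mem_filter, mem_univ, true_and] at h1 h2
    exact h1.1.1 h2.1

open Classical in
/-- `U = #{(¬B ∧ ¬B') ∧ R ∧ R'} + #{(¬B ∧ ¬B') ∧ R ∧ ¬R'} + #{(¬B ∧ ¬B') ∧ R' ∧ ¬R}`. -/
theorem card_U_split (c h h' : V) :
    (univ.filter fun O : Config E =>
        (G.Conn O c h ∨ G.Conn O c h') ∧ ¬ G.Conn Oᶜ c h ∧ ¬ G.Conn Oᶜ c h').card =
      (univ.filter fun O : Config E =>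
        (¬ G.Conn Oᶜ c h ∧ ¬ G.Conn Oᶜ c h') ∧ G.Conn O c h ∧ G.Conn O c h').card +
      (univ.filter fun O : Config E =>
        (¬ G.Conn Oᶜ c h ∧ ¬ G.Conn Oᶜ c h') ∧ G.Conn O c h ∧ ¬ G.Conn O c h').card +
      (univ.filter fun O : Config E =>
        (¬ G.Conn Oᶜ c h ∧ ¬ G.Conn Oᶜ c h') ∧ G.Conn O c h' ∧ ¬ G.Conn O c h).card := by
  rw [← Finset.card_union_of_disjoint, ← Finset.card_union_of_disjoint]
  · congr 1
    ext O
    simp only [mem_filter, mem_union, mem_univ, true_and]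
    tauto
  · rw [Finset.disjoint_left]
    intro O h1 h2
    simp only [mem_filter, mem_union, mem_univ, true_and] at h1 h2
    rcases h1 with h1 | h1
    · exact h2.2.2 h1.2.1
    · exact h1.2.2 h2.2.1
  · rw [Finset.disjoint_left]
    intro O h1 h2
    simp only [mem_filter, mem_univ, true_and] at h1 h2
    exact h2.2.2 h1.2.2

open Classical in
/-- `V ≤ U`. -/
theorem card_V_le_U (c h h' : V) :
    (univ.filter fun O : Config E =>
        (G.Conn O c h ∨ G.Conn O c h') ∧ ¬ G.Conn Oᶜ c h ∧ ¬ G.Conn Oᶜ c h' ∧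
          ¬ G.Conn Oᶜ h h').card ≤
      (univ.filter fun O : Config E =>
        (G.Conn O c h ∨ G.Conn O c h') ∧ ¬ G.Conn Oᶜ c h ∧ ¬ G.Conn Oᶜ c h').card :=
  Finset.card_le_card fun O hO => by
    simp only [mem_filter, mem_univ, true_and] at hO ⊢
    exact ⟨hO.1, hO.2.1, hO.2.2.1⟩

open Classical in
/-- `N₁ = U + W`: the configurations with `R ∨ R'` split by whether `c` is blue-joined to a hub. -/
theorem card_N_split (c h h' : V) :
    (univ.filter fun O : Config E => G.Conn O c h ∨ G.Conn O c h').card =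
      (univ.filter fun O : Config E =>
        (G.Conn O c h ∨ G.Conn O c h') ∧ ¬ G.Conn Oᶜ c h ∧ ¬ G.Conn Oᶜ c h').card +
      (univ.filter fun O : Config E =>
        (G.Conn O c h ∨ G.Conn O c h') ∧ (G.Conn Oᶜ c h ∨ G.Conn Oᶜ c h')).card := by
  rw [← Finset.card_union_of_disjoint]
  · congr 1
    ext O
    simp only [mem_filter, mem_union, mem_univ, true_and]
    tauto
  · rw [Finset.disjoint_left]
    intro O h1 h2
    simp only [mem_filter, mem_univ, true_and] at h1 h2
    exact h2.2.elim h1.2.1 h1.2.2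

open Classical in
/-- `z₁ + z₁' ≤ W`: two disjoint sub-events of `(R ∨ R') ∧ (B ∨ B')`. -/
theorem card_z_add_z_le (c h h' : V) :
    (univ.filter fun O : Config E =>
        G.Conn Oᶜ c h ∧ ¬ G.Conn Oᶜ c h' ∧ ¬ G.Conn O c h ∧ G.Conn O c h').card +
      (univ.filter fun O : Config E =>
        G.Conn Oᶜ c h' ∧ ¬ G.Conn Oᶜ c h ∧ ¬ G.Conn O c h' ∧ G.Conn O c h).card ≤
      (univ.filter fun O : Config E =>
        (G.Conn O c h ∨ G.Conn O c h') ∧ (G.Conn Oᶜ c h ∨ G.Conn Oᶜ c h')).card := by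
  rw [← Finset.card_union_of_disjoint]
  · refine Finset.card_le_card fun O hO => ?_
    simp only [mem_filter, mem_union, mem_univ, true_and] at hO ⊢
    rcases hO with hO | hO
    · exact ⟨Or.inr hO.2.2.2, Or.inl hO.1⟩
    · exact ⟨Or.inl hO.2.2.2, Or.inr hO.1⟩
  · rw [Finset.disjoint_left]
    intro O h1 h2
    simp only [mem_filter, mem_univ, true_and] at h1 h2
    exact h2.2.1 h1.1

open Classical in
/-- `a₀ + b ≤ P`. -/
theorem card_ab_le_P (c h h' : V) :
    (univ.filter fun O : Config E =>
        (¬ G.Conn Oᶜ c h ∧ ¬ G.Conn Oᶜ c h') ∧ G.Conn O c h ∧ G.Conn O c h').card +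
      (univ.filter fun O : Config E =>
        (¬ G.Conn Oᶜ c h ∧ ¬ G.Conn Oᶜ c h') ∧ G.Conn O c h ∧ ¬ G.Conn O c h').card ≤
      (univ.filter fun O : Config E => ¬ G.Conn Oᶜ c h' ∧ G.Conn O c h).card := by
  rw [← Finset.card_union_of_disjoint]
  · refine Finset.card_le_card fun O hO => ?_
    simp only [mem_filter, mem_union, mem_univ, true_and] at hO ⊢
    rcases hO with hO | hO
    · exact ⟨hO.1.2, hO.2.1⟩
    · exact ⟨hO.1.2, hO.2.1⟩
  · rw [Finset.disjoint_left]
    intro O h1 h2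
    simp only [mem_filter, mem_univ, true_and] at h1 h2
    exact h2.2.2 h1.2.2

open Classical in
/-- `a₀ + b' ≤ P'`. -/
theorem card_ab_le_P' (c h h' : V) :
    (univ.filter fun O : Config E =>
        (¬ G.Conn Oᶜ c h ∧ ¬ G.Conn Oᶜ c h') ∧ G.Conn O c h ∧ G.Conn O c h').card +
      (univ.filter fun O : Config E =>
        (¬ G.Conn Oᶜ c h ∧ ¬ G.Conn Oᶜ c h') ∧ G.Conn O c h' ∧ ¬ G.Conn O c h).card ≤
      (univ.filter fun O : Config E => ¬ G.Conn Oᶜ c h ∧ G.Conn O c h').card := by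
  rw [← Finset.card_union_of_disjoint]
  · refine Finset.card_le_card fun O hO => ?_
    simp only [mem_filter, mem_union, mem_univ, true_and] at hO ⊢
    rcases hO with hO | hO
    · exact ⟨hO.1.1, hO.2.2⟩
    · exact ⟨hO.1.1, hO.2.1⟩
  · rw [Finset.disjoint_left]
    intro O h1 h2
    simp only [mem_filter, mem_univ, true_and] at h1 h2
    exact h2.2.2 h1.2.1

open Classical in
/-- **STEP 3 of THEOREM B, the inequality `(★)` on the hub graph**:
`2·(Z + Z' + U + V) ≤ 2·N₁ + P + P' + 3·(X + X')`, in the form used by `twoHub_goodDegree`. -/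
theorem twoHub_star (c h h' : V) :
    2 * ((univ.filter fun O : Config E => G.Conn O c h ∨ G.Conn O c h').card +
      2 * (univ.filter fun O : Config E =>
        (G.Conn O c h ∨ G.Conn O c h') ∧ ¬ G.Conn Oᶜ c h').card +
      2 * (univ.filter fun O : Config E =>
        (G.Conn O c h ∨ G.Conn O c h') ∧ ¬ G.Conn Oᶜ c h).card +
      2 * (univ.filter fun O : Config E =>
        (G.Conn O c h ∨ G.Conn O c h') ∧ ¬ G.Conn Oᶜ c h ∧ ¬ G.Conn Oᶜ c h').card +
      2 * (univ.filter fun O : Config E =>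
        (G.Conn O c h ∨ G.Conn O c h') ∧ ¬ G.Conn Oᶜ c h ∧ ¬ G.Conn Oᶜ c h' ∧
          ¬ G.Conn Oᶜ h h').card) ≤
    3 * (2 * ((univ.filter fun O : Config E => G.Conn O c h ∨ G.Conn O c h').card +
      (univ.filter fun O : Config E => ¬ G.Conn Oᶜ c h' ∧ G.Conn O c h).card +
      (univ.filter fun O : Config E =>
        ¬ G.Conn Oᶜ c h' ∧ G.WalkAvoiding O (G.cluster Oᶜ h') c h).card +
      (univ.filter fun O : Config E => ¬ G.Conn Oᶜ c h ∧ G.Conn O c h').card +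
      (univ.filter fun O : Config E =>
        ¬ G.Conn Oᶜ c h ∧ G.WalkAvoiding O (G.cluster Oᶜ h) c h').card)) := by
  have hPZ := card_PZ_split (G := G) c h h'
  have hPZ' := card_PZ_split (G := G) c h' h
  have hZ := card_Z_split (G := G) c h h'
  have hZ' := card_Z_split (G := G) c h' h
  have hU := card_U_split (G := G) c h h'
  have hV := card_V_le_U (G := G) c h h'
  have hN := card_N_split (G := G) c h h'
  have hz := card_z_add_z_le (G := G) c h h'
  have hP := card_ab_le_P (G := G) c h h'
  have hP' := card_ab_le_P' (G := G) c h h'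
  have hb := card_blocked_le (G := G) c h h'
  have hb' := card_blocked_le' (G := G) c h h'
  -- the primed splits are stated with the hubs exchanged; align their filters
  have eR : (univ.filter fun O : Config E => G.Conn O c h' ∨ G.Conn O c h) =
      univ.filter fun O : Config E => G.Conn O c h ∨ G.Conn O c h' :=
    Finset.filter_congr fun O _ => or_comm
  have ePZ' : (univ.filter fun O : Config E =>
      (G.Conn O c h' ∨ G.Conn O c h) ∧ ¬ G.Conn Oᶜ c h) =
      univ.filter fun O : Config E => (G.Conn O c h ∨ G.Conn O c h') ∧ ¬ G.Conn Oᶜ c h :=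
    Finset.filter_congr fun O _ => and_congr_left fun _ => or_comm
  have eBB : (univ.filter fun O : Config E =>
      (¬ G.Conn Oᶜ c h' ∧ ¬ G.Conn Oᶜ c h) ∧ G.Conn O c h ∧ ¬ G.Conn O c h') =
      univ.filter fun O : Config E =>
        (¬ G.Conn Oᶜ c h ∧ ¬ G.Conn Oᶜ c h') ∧ G.Conn O c h ∧ ¬ G.Conn O c h' :=
    Finset.filter_congr fun O _ => and_congr_left fun _ => and_comm
  rw [ePZ'] at hPZ'
  rw [eBB] at hZ'
  omega

end Bookkeeping

section Main

variable [Fintype E] [DecidableEq E]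

open Classical in
/-- **THEOREM B (mine-3): ROW C-041 `(G⅔)` holds on every two-hub skeleton** — for every hub
graph `G` (with `a, b` edgeless in it), probe `c` and hubs `h, h'` with `a, b` distinct from each
other and from `c, h, h'`, on `H = G.attachTwoHub a b h h'` the average Good-degree of a `(D,A)`
source is at least `2/3`: `2·n(D,A) ≤ 3·(#Good_a + #Good_b)`. -/
theorem twoHub_goodDegree (hab : a ≠ b) (hca : c ≠ a) (hcb : c ≠ b) (hha : h ≠ a) (hhb : h ≠ b)
    (hh'a : h' ≠ a) (hh'b : h' ≠ b) (hisoa : ∀ e, G.fst e ≠ a ∧ G.snd e ≠ a)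
    (hisob : ∀ e, G.fst e ≠ b ∧ G.snd e ≠ b) :
    2 * (univ.filter fun S : Config (E ⊕ Fin 5) =>
        ((G.attachTwoHub a b h h').Conn S c a ∧ (G.attachTwoHub a b h h').Conn S c b) ∧
        (¬ (G.attachTwoHub a b h h').Conn Sᶜ c a ∧ ¬ (G.attachTwoHub a b h h').Conn Sᶜ c b ∧
          ¬ (G.attachTwoHub a b h h').Conn Sᶜ a b)).card ≤
      3 * ((univ.filter fun S : Config (E ⊕ Fin 5) =>
          (((G.attachTwoHub a b h h').Conn S c a ∧ (G.attachTwoHub a b h h').Conn S c b) ∧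
          (¬ (G.attachTwoHub a b h h').Conn Sᶜ c a ∧ ¬ (G.attachTwoHub a b h h').Conn Sᶜ c b ∧
            ¬ (G.attachTwoHub a b h h').Conn Sᶜ a b)) ∧
          (G.attachTwoHub a b h h').WalkAvoiding S ((G.attachTwoHub a b h h').cluster Sᶜ a)
            c b).card +
        (univ.filter fun S : Config (E ⊕ Fin 5) =>
          (((G.attachTwoHub a b h h').Conn S c a ∧ (G.attachTwoHub a b h h').Conn S c b) ∧
          (¬ (G.attachTwoHub a b h h').Conn Sᶜ c a ∧ ¬ (G.attachTwoHub a b h h').Conn Sᶜ c b ∧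
            ¬ (G.attachTwoHub a b h h').Conn Sᶜ a b)) ∧
          (G.attachTwoHub a b h h').WalkAvoiding S ((G.attachTwoHub a b h h').cluster Sᶜ b)
            c a).card) := by
  rw [card_DA_attach hab hca hcb hha hhb hh'a hh'b hisoa hisob,
    card_goodA_attach hab hca hcb hha hhb hh'a hh'b hisoa hisob,
    card_goodB_attach hab hca hcb hha hhb hh'a hh'b hisoa hisob]
  have := twoHub_star (G := G) c h h'
  omega

open Classical in
/-- **THEOREM L2 on the two-hub class**: CONJECTURE (P) holds at every band state of the probe and
of the two live vertices on every two-hub skeleton — `(G⅔)` there (`twoHub_goodDegree`) through the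
bridge `pFun_threeCells_nonneg_of_goodDegree`. -/
theorem pFun_threeCells_nonneg_twoHub [Fintype V] [DecidableEq V] (hab : a ≠ b) (hca : c ≠ a)
    (hcb : c ≠ b) (hha : h ≠ a) (hhb : h ≠ b) (hh'a : h' ≠ a) (hh'b : h' ≠ b)
    (hisoa : ∀ e, G.fst e ≠ a ∧ G.snd e ≠ a) (hisob : ∀ e, G.fst e ≠ b ∧ G.snd e ≠ b)
    {z κ x₁ K₁ x₂ K₂ : ℝ} (hz : 0 ≤ z ∧ z ≤ 1) (hκ : kMin z ≤ κ) (hx₁ : 0 ≤ x₁ ∧ x₁ ≤ 1)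
    (hx₂ : 0 ≤ x₂ ∧ x₂ ≤ 1) (hK₁ : kMin x₁ ≤ K₁) (hK₂ : kMin x₂ ≤ K₂) :
    0 ≤ (G.attachTwoHub a b h h').pFun c (threeCells c a b z x₁ x₂) (threeCells c a b κ K₁ K₂)
      univ :=
  pFun_threeCells_nonneg_of_goodDegree a b c
    (twoHub_goodDegree hab hca hcb hha hhb hh'a hh'b hisoa hisob) hz hκ hx₁ hx₂ hK₁ hK₂

end Main

end MultiGraph

end PercRepro
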